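import Summits.CriticalPhenomena.PercolationContinuityZ3.Theorems.PercNearOneGluingNoHeavyLowerTailSahiOneStepProfileGridCaterpillar
import Summits.CriticalPhenomena.PercolationContinuityZ3.Theorems.PercNearOneGluingNoHeavyLowerTailSahiOneStepDisjointAndOr
import HarnessLib

/-!
# One-step scheme: `(2′)` and Kahn C5 / Sahi `C₃` for every CATERPILLAR READ-ONCE FORMULA OF THRESHOLDS OF DISJOINT BLOCKS
# against an ARBITRARY increasing event, every product measure (THEOREM G45-B on the cube)

Prover prim-ineq-prove-3 gen 46 (`--supports stmt-CriticalPhenomena-4575`; memo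
`run/shared/lean/prim/prim-ineq-prove-3/PROOF-G45-CHAIN-RULE.md` §6).  Cube corollary of the profile-grid theorem
`ProfileGrid.gridK_caterpillar_nonneg` (`…SahiOneStepProfileGridCaterpillar`); the push-forward to the profile grid is the one
of `…SahiOneStepDisjointOr` (gen 44) / `…SahiOneStepDisjointAndOr` (gen 45), here stated once for an ARBITRARY profile event
(`osN_threshold_profile_nonneg_of_grid`: every event of the block counts whose grid version is a universal `(2′)`-partner on
products of `PF₂` chains satisfies `(2′)` on the cube against every increasing event).  No definitions, no sorries.

* `osN_threshold_caterpillar_nonneg` — for every product measure, every block `F`, every `t`, every finite family of pairwise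
  DISJOINT blocks `S_j ⊆ F` and EVERY increasing `U`: `0 ≤ n(1_U, 1_B)` at the slot `{N_F ≥ t}` for every caterpillar read-once
  formula `B = U₁ ∘₁ (U₂ ∘₂ (⋯ ∘ U_k))`, `∘ ∈ {∧, ∨}`, `U_m = {N_{S_{j_m}} ≥ c_m}` (a list of nodes `(j, c, tag)`, `tag = true` = AND,
  `tag = false` = OR with a block not used further inside; innermost formula `True`).
  Examples: `{N_{S₁} ≥ 2} ∨ ({N_{S₂} ≥ 1} ∧ {N_{S₃} ≥ 3})`, `maj(S₁) ∨ (maj(S₂) ∧ maj(S₃))` (`osN_threshold_orAnd_nonneg`), every OR /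
  AND / box ∩ OR of block thresholds (gens 44, 45), every literal caterpillar (gen 26).
* `sahiE3_threshold_caterpillar_nonneg(')` — with the `(3′)` half (`osMp_threshold_nonneg_all`): **Kahn C5 / Sahi `C₃`**
  `0 ≤ E₃(1_{N_F ≥ t}, 1_U, 1_B)` for these `B`, both slot orders.
NOT covered (PROOF-G45 §6): non-caterpillar read-once trees `(U₁ ∧ U₂) ∨ (U₃ ∧ U₄)`, 2-clause CNFs of block thresholds,
thresholds of overlapping blocks, weighted sums.
-/

noncomputable section

namespace Summit.CriticalPhenomena.PercolationContinuityZ3.Theorems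

namespace SahiOneStep

open MeasureTheory Finset Function
open Literature.Probability.LatticeModels (prodBernoulli sahiE3)
open Literature.Probability.Percolation.DecisionTree (ind)
open Literature.Probability.Distributions (IsLogConcaveSeq piWeight blockSum)
open scoped Classical

variable {ι : Type*} [Fintype ι] [DecidableEq ι]

/-! ## The push-forward for an arbitrary profile event -/

/-- **Generic push-forward.**  Blocks `R = F ∖ ⋃ S_j` (index `none`) and `S_j` (index `some j`).  Let `PB` be an event of the
block-count vector whose grid version `{v | PB (j ↦ v_j)}` is a universal `(2′)`-partner on products of `PF₂` chains over
`Option κ₀` (the homogeneous one-step functional `K̃` of `…ProfileGridChainRule` is `≥ 0` for all `PF₂` weights and all numerators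
with the cross inequalities, at the slot `t`).  Then for the cube event `B = {ω | PB (j ↦ N_{blk j}(ω))}` and every increasing `U`:
`0 ≤ n(1_U, 1_B)` at `{N_F ≥ t}`. [this work] -/
theorem osN_threshold_profile_nonneg_of_grid (p : ι → unitInterval) (F : Finset ι) (t : ℕ) {κ₀ : Type*} [Fintype κ₀]
    [DecidableEq κ₀] (S : κ₀ → Finset ι) (hSF : ∀ j, S j ⊆ F) (hdisj : ∀ j j', j ≠ j' → Disjoint (S j) (S j'))
    (PB : (Option κ₀ → ℕ) → Prop) [DecidablePred PB]
    (hgrid : ∀ (φ : Option κ₀ → ℕ → ℝ), (∀ j, IsLogConcaveSeq (φ j)) → ∀ (u : (Option κ₀ → Fin (F.card + 1)) → ℝ),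
      (∀ v, 0 ≤ u v) → (∀ v, u v ≤ piWeight F.card φ v) →
      (∀ v j (x x' : Fin (F.card + 1)), x ≤ x' → u (update v j x) * φ j x' ≤ u (update v j x') * φ j x) →
      0 ≤ (∑ v, piWeight F.card φ v) * (∑ v, if ¬ t ≤ blockSum univ v then piWeight F.card φ v else 0) *
            (∑ v, if t ≤ blockSum univ v ∧ PB (fun j => (v j : ℕ)) then u v else 0)
        + (∑ v, piWeight F.card φ v) * (∑ v, if ¬ t ≤ blockSum univ v then u v else 0) *
            (∑ v, if PB (fun j => (v j : ℕ)) ∧ ¬ t ≤ blockSum univ v then piWeight F.card φ v else 0)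
        - (∑ v, if ¬ t ≤ blockSum univ v then piWeight F.card φ v else 0) * (∑ v, u v) *
            (∑ v, if PB (fun j => (v j : ℕ)) then piWeight F.card φ v else 0))
    {U : Set (Set ι)} (hU : IsUpperSet U) {B : Set (Set ι)}
    (hB : ∀ ω, ω ∈ B ↔ PB (fun j => ((Option.elim j (F \ univ.biUnion S) S).filter (· ∈ ω)).card)) :
    0 ≤ osN p {ω : Set ι | t ≤ (F.filter (· ∈ ω)).card} (ind U) (ind B) := by
  set N : ℕ := F.card with hN
  set blk : Option κ₀ → Finset ι := fun j => Option.elim j (F \ univ.biUnion S) S with hblk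
  have hblkF : ∀ j, blk j ⊆ F := fun j => by
    cases j with
    | none => exact sdiff_subset
    | some j => exact hSF j
  have hblkN : ∀ j, (blk j).card ≤ N := fun j => card_le_card (hblkF j)
  have hblkdisj : ∀ j j', j ≠ j' → Disjoint (blk j) (blk j') := by
    intro j j' hjj'
    cases j with
    | none =>
      cases j' with
      | none => exact absurd rfl hjj'
      | some b => exact Finset.sdiff_disjoint.mono_right (subset_biUnion_of_mem S (mem_univ b))
    | some a =>
      cases j' with
      | none => exact (Finset.sdiff_disjoint.mono_right (subset_biUnion_of_mem S (mem_univ a))).symm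
      | some b => exact hdisj a b (fun h => hjj' (by rw [h]))
  have hFeq : F = univ.biUnion blk := by
    ext i
    simp only [mem_biUnion, mem_univ, true_and]
    constructor
    · intro hi
      by_cases h : ∃ j, i ∈ S j
      · obtain ⟨j, hj⟩ := h; exact ⟨some j, hj⟩
      · refine ⟨none, ?_⟩
        show i ∈ F \ univ.biUnion S
        rw [mem_sdiff, mem_biUnion]; exact ⟨hi, fun ⟨j, _, hj⟩ => h ⟨j, hj⟩⟩
    · rintro ⟨j, hj⟩; exact hblkF j hj
  have hcardF : ∀ ω : Set ι, (F.filter (· ∈ ω)).card = ∑ j, ((blk j).filter (· ∈ ω)).card := by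
    intro ω
    rw [hFeq, filter_biUnion, card_biUnion]
    intro j _ j' _ hjj'
    exact disjoint_filter_filter (hblkdisj j j' hjj')
  set φ : Option κ₀ → ℕ → ℝ := fun j n => (prodBernoulli p).real {ω : Set ι | ((blk j).filter (· ∈ ω)).card = n} with hφ
  set u : (Option κ₀ → Fin (N + 1)) → ℝ := fun v => (prodBernoulli p).real (U ∩ {ω : Set ι | prof blk N hblkN ω = v}) with hu
  have hφlc : ∀ j, IsLogConcaveSeq (φ j) := fun j => isLogConcaveSeq_real_layer p (blk j)
  have hφ1 : ∀ j, ∑ n : Fin (N + 1), φ j n = 1 := by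
    intro j
    rw [Fin.sum_univ_eq_sum_range (fun n => φ j n) (N + 1), ← sum_real_layer_eq_one p (blk j),
      ← sum_range_add_sum_Ico _ (show (blk j).card + 1 ≤ N + 1 by have := hblkN j; omega)]
    rw [sum_eq_zero (s := Ico ((blk j).card + 1) (N + 1)) (fun n hn => by
      have hn' := (mem_Ico.1 hn).1
      simp only [hφ]
      rw [show {ω : Set ι | ((blk j).filter (· ∈ ω)).card = n} = ∅ from by
        ext ω; simp only [Set.mem_setOf_eq, Set.mem_empty_iff_false, iff_false]
        intro h; have := card_filter_le (blk j) (· ∈ ω); omega]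
      exact measureReal_empty), add_zero]
  have hu0 : ∀ v, 0 ≤ u v := fun v => measureReal_nonneg
  have hcell : ∀ v : Option κ₀ → Fin (N + 1), (prodBernoulli p).real {ω : Set ι | prof blk N hblkN ω = v} = piWeight N φ v :=
    fun v => real_prof_eq_prod p blk hblkdisj N hblkN v
  have huΦ : ∀ v, u v ≤ piWeight N φ v := fun v => by
    rw [← hcell]; exact measureReal_mono Set.inter_subset_right
  have hmono : ∀ v j (x x' : Fin (N + 1)), x ≤ x' → u (update v j x) * φ j x' ≤ u (update v j x') * φ j x :=
    fun v j x x' hxx' => real_inter_prof_update_mul_le p blk hblkdisj N hblkN hU v j hxx'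
  have hsum1 : ∑ v, piWeight N φ v = 1 := by
    rw [ProfileGrid.sum_piWeight_eq_prod, prod_congr rfl fun j _ => hφ1 j]; simp
  have hgrid' := hgrid φ hφlc u hu0 huΦ hmono
  rw [← ProfileGrid.fiveTerm_eq_gridK t (piWeight N φ) u (fun v => PB (fun j => (v j : ℕ))) hsum1] at hgrid'
  set H : Set (Set ι) := {ω : Set ι | t ≤ (F.filter (· ∈ ω)).card} with hH
  have memH : ∀ ω : Set ι, ω ∈ H ↔ t ≤ blockSum univ (prof blk N hblkN ω) := fun ω => by
    rw [hH, Set.mem_setOf_eq, hcardF ω, blockSum]; simp only [prof_val]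
  have memB : ∀ ω : Set ι, ω ∈ B ↔ PB (fun j => (prof blk N hblkN ω j : ℕ)) := fun ω => by
    rw [hB ω]; simp only [prof_val, hblk]
  have memHB : ∀ ω : Set ι, ω ∈ H ∩ B ↔ t ≤ blockSum univ (prof blk N hblkN ω) ∧
      PB (fun j => (prof blk N hblkN ω j : ℕ)) := fun ω => by
    rw [Set.mem_inter_iff, memH, memB]
  -- the five measures as grid sums
  have eHU : (prodBernoulli p).real (H ∩ U) =
      ∑ v : Option κ₀ → Fin (N + 1), if t ≤ blockSum univ v then u v else 0 := by
    rw [real_eq_sum_prof p blk N hblkN]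
    exact Fintype.sum_congr _ _ fun v =>
      real_inter_prof_eq_ite p blk N hblkN (E := H) (X := U) (fun v => t ≤ blockSum univ v) memH v
  have eHB : (prodBernoulli p).real (H ∩ B) = ∑ v : Option κ₀ → Fin (N + 1),
      if t ≤ blockSum univ v ∧ PB (fun j => (v j : ℕ)) then piWeight N φ v else 0 := by
    rw [real_eq_sum_prof p blk N hblkN]
    refine Fintype.sum_congr _ _ fun v => ?_
    rw [← Set.inter_univ (H ∩ B), real_inter_prof_eq_ite p blk N hblkN (E := H ∩ B) (X := Set.univ)
      (fun v => t ≤ blockSum univ v ∧ PB (fun j => (v j : ℕ))) memHB v, Set.univ_inter, hcell]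
  have eH : (prodBernoulli p).real H = ∑ v : Option κ₀ → Fin (N + 1), if t ≤ blockSum univ v then piWeight N φ v else 0 := by
    rw [real_eq_sum_prof p blk N hblkN]
    refine Fintype.sum_congr _ _ fun v => ?_
    rw [← Set.inter_univ H, real_inter_prof_eq_ite p blk N hblkN (E := H) (X := Set.univ) (fun v => t ≤ blockSum univ v) memH v,
      Set.univ_inter, hcell]
  have eHUB : (prodBernoulli p).real (H ∩ U ∩ B) = ∑ v : Option κ₀ → Fin (N + 1),
      if t ≤ blockSum univ v ∧ PB (fun j => (v j : ℕ)) then u v else 0 := by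
    rw [show H ∩ U ∩ B = (H ∩ B) ∩ U from by rw [Set.inter_assoc, Set.inter_comm U B, ← Set.inter_assoc],
      real_eq_sum_prof p blk N hblkN]
    exact Fintype.sum_congr _ _ fun v => real_inter_prof_eq_ite p blk N hblkN (E := H ∩ B) (X := U)
      (fun v => t ≤ blockSum univ v ∧ PB (fun j => (v j : ℕ))) memHB v
  have eU : (prodBernoulli p).real U = ∑ v : Option κ₀ → Fin (N + 1), u v := real_eq_sum_prof p blk N hblkN U
  have eB : (prodBernoulli p).real B = ∑ v : Option κ₀ → Fin (N + 1),
      if PB (fun j => (v j : ℕ)) then piWeight N φ v else 0 := by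
    rw [real_eq_sum_prof p blk N hblkN]
    refine Fintype.sum_congr _ _ fun v => ?_
    rw [← Set.inter_univ B, real_inter_prof_eq_ite p blk N hblkN (E := B) (X := Set.univ)
      (fun v => PB (fun j => (v j : ℕ))) memB v, Set.univ_inter, hcell]
  rw [osN_ind_ind, eHU, eHB, eH, eHUB, eU, eB]
  exact hgrid'

/-! ## Caterpillar formulas of block counts -/

omit [Fintype ι] [DecidableEq ι] in
/-- The caterpillar formula read through the `some`-blocks of `Option κ₀` is the caterpillar formula of the blocks. [this work] -/
theorem caterpillar_foldr_map_some {κ₀ : Type*} (L : List (κ₀ × ℕ × Bool)) (cnt : Option κ₀ → ℕ) :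
    (L.map fun e => ((some e.1 : Option κ₀), e.2)).foldr
        (fun e P => bif e.2.2 then (e.2.1 ≤ cnt e.1 ∧ P) else (e.2.1 ≤ cnt e.1 ∨ P)) True ↔
      L.foldr (fun e P => bif e.2.2 then (e.2.1 ≤ cnt (some e.1) ∧ P) else (e.2.1 ≤ cnt (some e.1) ∨ P)) True := by
  induction L with
  | nil => exact Iff.rfl
  | cons e L IH =>
    obtain ⟨j, c, b⟩ := e
    cases b
    · simp only [List.map_cons, List.foldr_cons, cond_false]; rw [IH]
    · simp only [List.map_cons, List.foldr_cons, cond_true]; rw [IH]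

omit [Fintype ι] [DecidableEq ι] in
/-- A caterpillar formula of block thresholds is an increasing event. [this work] -/
theorem isUpperSet_caterpillar {κ₀ : Type*} (S : κ₀ → Finset ι) (L : List (κ₀ × ℕ × Bool)) :
    IsUpperSet {ω : Set ι | L.foldr (fun e P => bif e.2.2 then (e.2.1 ≤ ((S e.1).filter (· ∈ ω)).card ∧ P)
      else (e.2.1 ≤ ((S e.1).filter (· ∈ ω)).card ∨ P)) True} := by
  intro ω ω' hle
  have hmono : ∀ j, ((S j).filter (· ∈ ω)).card ≤ ((S j).filter (· ∈ ω')).card := fun j =>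
    card_le_card fun i hi => by rw [mem_filter] at hi ⊢; exact ⟨hi.1, hle hi.2⟩
  simp only [Set.mem_setOf_eq]
  induction L with
  | nil => exact fun _ => trivial
  | cons e L IH =>
    obtain ⟨j, c, b⟩ := e
    cases b
    · simp only [List.foldr_cons, cond_false]
      exact fun h => h.elim (fun hc => Or.inl (hc.trans (hmono j))) (fun h' => Or.inr (IH h'))
    · simp only [List.foldr_cons, cond_true]
      exact fun h => ⟨h.1.trans (hmono j), IH h.2⟩

/-! ## THE THEOREMS -/

/-- **`(2′)` FOR EVERY CATERPILLAR READ-ONCE FORMULA OF THRESHOLDS OF DISJOINT BLOCKS (THEOREM G45-B on the cube).**  For every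
product measure, every block `F`, every `t`, every finite family of pairwise disjoint `S_j ⊆ F`, every list of nodes `(j, c, tag)`
(`tag = true`: AND-node `{N_{S_j} ≥ c} ∩ ·`; `tag = false`: OR-node `{N_{S_j} ≥ c} ∪ ·` with `S_j` not used further inside) and EVERY
increasing event `U`: `0 ≤ n(1_U, 1_B)` at the slot `{N_F ≥ t}` for the event `B` of the formula. [this work] -/
theorem osN_threshold_caterpillar_nonneg (p : ι → unitInterval) (F : Finset ι) (t : ℕ) {κ₀ : Type*} [Fintype κ₀]
    [DecidableEq κ₀] (S : κ₀ → Finset ι) (hSF : ∀ j, S j ⊆ F) (hdisj : ∀ j j', j ≠ j' → Disjoint (S j) (S j'))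
    (L : List (κ₀ × ℕ × Bool)) (hL : L.Pairwise (fun e e' => e.2.2 = false → e.1 ≠ e'.1))
    {U : Set (Set ι)} (hU : IsUpperSet U) :
    0 ≤ osN p {ω : Set ι | t ≤ (F.filter (· ∈ ω)).card} (ind U)
      (ind {ω : Set ι | L.foldr (fun e P => bif e.2.2 then (e.2.1 ≤ ((S e.1).filter (· ∈ ω)).card ∧ P)
        else (e.2.1 ≤ ((S e.1).filter (· ∈ ω)).card ∨ P)) True}) := by
  have hL' : (L.map fun e => ((some e.1 : Option κ₀), e.2)).Pairwise (fun e e' => e.2.2 = false → e.1 ≠ e'.1) :=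
    List.pairwise_map.2 (hL.imp fun {a b} h hb heq => h hb (Option.some_injective _ heq))
  refine osN_threshold_profile_nonneg_of_grid p F t S hSF hdisj
    (fun cnt => L.foldr (fun e P => bif e.2.2 then (e.2.1 ≤ cnt (some e.1) ∧ P) else (e.2.1 ≤ cnt (some e.1) ∨ P)) True)
    (fun φ hφ u hu0 huΦ hmono => ?_) hU (fun ω => ?_)
  · exact (ProfileGrid.gridK_caterpillar_nonneg _ hL' φ hφ t u hu0 huΦ hmono).trans_eq
      (ProfileGrid.gridK_congr_prop t _ u (fun v => caterpillar_foldr_map_some L (fun j => (v j : ℕ))))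
  · simp only [Set.mem_setOf_eq, Option.elim_some]

/-- **Example: `B = {N_{S₁} ≥ c₁} ∪ ({N_{S₂} ≥ c₂} ∩ {N_{S₃} ≥ c₃})`** for three pairwise disjoint blocks (e.g.
`maj(S₁) ∨ (maj(S₂) ∧ maj(S₃))`), every increasing `U`, every product measure: `0 ≤ n(1_U, 1_B)` at `{N_F ≥ t}`. [this work] -/
theorem osN_threshold_orAnd_nonneg (p : ι → unitInterval) (F : Finset ι) (t : ℕ) (S : Fin 3 → Finset ι) (hSF : ∀ j, S j ⊆ F)
    (hdisj : ∀ j j', j ≠ j' → Disjoint (S j) (S j')) (c : Fin 3 → ℕ) {U : Set (Set ι)} (hU : IsUpperSet U) :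
    0 ≤ osN p {ω : Set ι | t ≤ (F.filter (· ∈ ω)).card} (ind U)
      (ind {ω : Set ι | c 0 ≤ ((S 0).filter (· ∈ ω)).card ∨
        (c 1 ≤ ((S 1).filter (· ∈ ω)).card ∧ c 2 ≤ ((S 2).filter (· ∈ ω)).card)}) := by
  have h := osN_threshold_caterpillar_nonneg p F t S hSF hdisj [(0, c 0, false), (1, c 1, true), (2, c 2, true)]
    (by simp) hU
  have e : {ω : Set ι | List.foldr (fun (e : Fin 3 × ℕ × Bool) P => bif e.2.2 then (e.2.1 ≤ ((S e.1).filter (· ∈ ω)).card ∧ P)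
      else (e.2.1 ≤ ((S e.1).filter (· ∈ ω)).card ∨ P)) True [(0, c 0, false), (1, c 1, true), (2, c 2, true)]} =
      {ω : Set ι | c 0 ≤ ((S 0).filter (· ∈ ω)).card ∨
        (c 1 ≤ ((S 1).filter (· ∈ ω)).card ∧ c 2 ≤ ((S 2).filter (· ∈ ω)).card)} := by
    ext ω; simp only [Set.mem_setOf_eq, List.foldr_cons, List.foldr_nil, cond_true, cond_false, and_true]
  rw [e] at h
  exact h

/-- **KAHN C5 / SAHI `C₃` for a Hamming threshold, a caterpillar read-once formula of thresholds of disjoint blocks and an arbitrary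
increasing event**, every product measure: `0 ≤ E₃(1_{N_F ≥ t}, 1_U, 1_B)`. [this work] -/
theorem sahiE3_threshold_caterpillar_nonneg (p : ι → unitInterval) (F : Finset ι) (t : ℕ) {κ₀ : Type*} [Fintype κ₀]
    [DecidableEq κ₀] (S : κ₀ → Finset ι) (hSF : ∀ j, S j ⊆ F) (hdisj : ∀ j j', j ≠ j' → Disjoint (S j) (S j'))
    (L : List (κ₀ × ℕ × Bool)) (hL : L.Pairwise (fun e e' => e.2.2 = false → e.1 ≠ e'.1))
    {U : Set (Set ι)} (hU : IsUpperSet U) :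
    0 ≤ sahiE3 (prodBernoulli p) {ω : Set ι | t ≤ (F.filter (· ∈ ω)).card} U
      {ω : Set ι | L.foldr (fun e P => bif e.2.2 then (e.2.1 ≤ ((S e.1).filter (· ∈ ω)).card ∧ P)
        else (e.2.1 ≤ ((S e.1).filter (· ∈ ω)).card ∨ P)) True} := by
  have hB := isUpperSet_caterpillar S L
  rw [← osT_ind_ind, osT_eq_osMp_add_osN]
  exact add_nonneg (osMp_threshold_nonneg_all p F t hU hB) (osN_threshold_caterpillar_nonneg p F t S hSF hdisj L hL hU)

/-- The same with the two slots exchanged. [this work] -/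
theorem sahiE3_threshold_caterpillar_nonneg' (p : ι → unitInterval) (F : Finset ι) (t : ℕ) {κ₀ : Type*} [Fintype κ₀]
    [DecidableEq κ₀] (S : κ₀ → Finset ι) (hSF : ∀ j, S j ⊆ F) (hdisj : ∀ j j', j ≠ j' → Disjoint (S j) (S j'))
    (L : List (κ₀ × ℕ × Bool)) (hL : L.Pairwise (fun e e' => e.2.2 = false → e.1 ≠ e'.1))
    {U : Set (Set ι)} (hU : IsUpperSet U) :
    0 ≤ sahiE3 (prodBernoulli p) {ω : Set ι | t ≤ (F.filter (· ∈ ω)).card}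
      {ω : Set ι | L.foldr (fun e P => bif e.2.2 then (e.2.1 ≤ ((S e.1).filter (· ∈ ω)).card ∧ P)
        else (e.2.1 ≤ ((S e.1).filter (· ∈ ω)).card ∨ P)) True} U := by
  have hB := isUpperSet_caterpillar S L
  rw [← osT_ind_ind, osT_eq_osMp_add_osN, osN_comm]
  exact add_nonneg (osMp_threshold_nonneg_all p F t hB hU) (osN_threshold_caterpillar_nonneg p F t S hSF hdisj L hL hU)

end SahiOneStep

end Summit.CriticalPhenomena.PercolationContinuityZ3.Theorems
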